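import Mathlib

/-!
# The four-character constraint `x₀ x₁ = x₂ x₃` on cofinite / infinite sets — the set-theoretic glue of (R2)

Blind re-derivation cell `pub-hodge-repro`, seat `t3-p4` (Tier 3, T3.5 Lean item beside T3.2).  Target tree path
`lean/Summits/Ventures/HodgeRepro/Tier3PairCombinatorics.lean`; Mathlib only.

route/TIER3.md (lead g110, STATUS S9699, 13:39Z) states the exact form of the residual (R2) handed over by t3-p1:
«∃ x_j ∈ S_j, x₀ x₁ = x₂ x₃», with `S_j = {x ∈ Ξ_𝔭 : ε(χ′_j x) = +1 ∧ L(½, χ′_j x) ≠ 0}` subsets of the group `Ξ_𝔭` of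
finite-order anticyclotomic characters, and records: «one S_j cofinite + the others infinite suffices».  This file proves
that sentence — with weaker hypotheses — as a statement about four subsets of a commutative group:

* `exists_mul_eq_mul_of_cofinite_of_infinite`: if `S₀` is cofinite, `S₁` is infinite and `S₂`, `S₃` are non-empty, then
  there are `x_j ∈ S_j` with `x₀ * x₁ = x₂ * x₃` (fix `x₂ ∈ S₂`, `x₃ ∈ S₃`; as `x₁` runs through the infinite `S₁` the
  forced `x₀ = x₂ x₃ x₁⁻¹` runs through infinitely many elements, one of which avoids the finite complement of `S₀`);
* `exists_mul_eq_mul_of_cofinite` — the cofinite-intersection form: if all four `S_j` are cofinite in an infinite group,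
  the same conclusion (a corollary).

WHERE IT ENTERS.  T3.2 (method (b′)) produces, for each corner character `χ′_j`, a COFINITE set `S_j` from the
Weierstrass argument (`Tier3Weierstrass.lean`: a non-zero Katz element has finitely many zeros among the `ζ − 1`) or an
INFINITE set from the «infinitely many ν» statements of the published line; this file says exactly which combination of
those two qualities closes (R2)'s constraint.  Nothing here is about `L`-values or characters; HC_CM is NOT proved by
anyone in this repository.
-/

set_option autoImplicit false

namespace HodgeRepro.Tier3

variable {Ξ : Type*} [CommGroup Ξ]

/-- **One cofinite set and one infinite set suffice**: for subsets `S₀ S₁ S₂ S₃` of a commutative group with `S₀ᶜ`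
finite, `S₁` infinite and `S₂`, `S₃` non-empty, there are `x_j ∈ S_j` with `x₀ * x₁ = x₂ * x₃`. -/
theorem exists_mul_eq_mul_of_cofinite_of_infinite {S₀ S₁ S₂ S₃ : Set Ξ} (h₀ : S₀ᶜ.Finite)
    (h₁ : S₁.Infinite) (h₂ : S₂.Nonempty) (h₃ : S₃.Nonempty) :
    ∃ x₀ ∈ S₀, ∃ x₁ ∈ S₁, ∃ x₂ ∈ S₂, ∃ x₃ ∈ S₃, x₀ * x₁ = x₂ * x₃ := by
  obtain ⟨x₂, hx₂⟩ := h₂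
  obtain ⟨x₃, hx₃⟩ := h₃
  -- the forced `x₀` as a function of `x₁`, injective
  have hinj : Function.Injective fun x₁ : Ξ => x₂ * x₃ * x₁⁻¹ := by
    intro a b hab
    simpa using hab
  -- its image over the infinite `S₁` is infinite, hence not contained in the finite `S₀ᶜ`
  have himg : ((fun x₁ : Ξ => x₂ * x₃ * x₁⁻¹) '' S₁).Infinite := h₁.image hinj.injOn
  obtain ⟨y, ⟨x₁, hx₁, rfl⟩, hy⟩ := himg.exists_notMem_finite h₀
  refine ⟨x₂ * x₃ * x₁⁻¹, ?_, x₁, hx₁, x₂, hx₂, x₃, hx₃, by group⟩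
  simpa using hy

/-- **The cofinite-intersection form**: in an infinite commutative group, four cofinite subsets always admit `x_j ∈ S_j`
with `x₀ * x₁ = x₂ * x₃`. -/
theorem exists_mul_eq_mul_of_cofinite [Infinite Ξ] {S₀ S₁ S₂ S₃ : Set Ξ} (h₀ : S₀ᶜ.Finite)
    (h₁ : S₁ᶜ.Finite) (h₂ : S₂ᶜ.Finite) (h₃ : S₃ᶜ.Finite) :
    ∃ x₀ ∈ S₀, ∃ x₁ ∈ S₁, ∃ x₂ ∈ S₂, ∃ x₃ ∈ S₃, x₀ * x₁ = x₂ * x₃ :=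
  exists_mul_eq_mul_of_cofinite_of_infinite h₀ (Set.infinite_of_finite_compl h₁)
    (Set.infinite_of_finite_compl h₂).nonempty (Set.infinite_of_finite_compl h₃).nonempty

/-- The same with the INFINITE set on the other side of the equation: `S₀` cofinite, `S₂` infinite, `S₁`, `S₃`
non-empty (the forced `x₀ = x₂ x₃ x₁⁻¹` now runs over the infinite `S₂`).  Together with the commutativity of the two
sides, any one cofinite `S_j` and any other infinite `S_k` suffice. -/
theorem exists_mul_eq_mul_of_cofinite_of_infinite' {S₀ S₁ S₂ S₃ : Set Ξ} (h₀ : S₀ᶜ.Finite)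
    (h₁ : S₁.Nonempty) (h₂ : S₂.Infinite) (h₃ : S₃.Nonempty) :
    ∃ x₀ ∈ S₀, ∃ x₁ ∈ S₁, ∃ x₂ ∈ S₂, ∃ x₃ ∈ S₃, x₀ * x₁ = x₂ * x₃ := by
  obtain ⟨x₁, hx₁⟩ := h₁
  obtain ⟨x₃, hx₃⟩ := h₃
  have hinj : Function.Injective fun x₂ : Ξ => x₂ * x₃ * x₁⁻¹ := by
    intro a b hab
    simpa using hab
  have himg : ((fun x₂ : Ξ => x₂ * x₃ * x₁⁻¹) '' S₂).Infinite := h₂.image hinj.injOn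
  obtain ⟨y, ⟨x₂, hx₂, rfl⟩, hy⟩ := himg.exists_notMem_finite h₀
  refine ⟨x₂ * x₃ * x₁⁻¹, ?_, x₁, hx₁, x₂, hx₂, x₃, hx₃, by group⟩
  simpa using hy

end HodgeRepro.Tier3
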